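import Summits.CriticalPhenomena.SAWScalingLimit.Theses.SAWRenewalTightness
import Summits.CriticalPhenomena.SAWScalingLimit.Theorems.ShellCrossingBound.Negative.OfEventualTight
import Summits.CriticalPhenomena.SAWScalingLimit.Theorems.EventualTight.Negative.TightnessNecessary
import HarnessLib

/-!
# `BulkShellTight` is necessary: `EventualTight → BulkShellTight`, hence `SAWScalingLimit → BulkShellTight`

Honesty certificate for the bulk child of the strategist split of the crux `EventualTight`
(stmt-CriticalPhenomena-1372 ⟸ stmt-17587 `ConfinementPositivity` ∧ stmt-17588 `BulkShellTight`, glue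
stmt-17589 `EventualTight_of_subs`, landed p142144).  The split is LOSSLESS on the bulk side: per-shell
count tightness on interior shells is an instance of "every positive shell-dependent target is met under
`EventualTight`" (`ShellCrossingBound.Negative.anyTarget_of_eventualTight`, the Aizenman–Burchard
compactness criterion read backwards), with the constant target `ε`; and the crux is itself necessary for
the summit conjunct (`EventualTight.Negative.not_sawScalingLimit_of_not_eventualTight`).  So a refutation
of stmt-17588 refutes the crux and the Lawler–Schramm–Werner conjecture as typed: the item is summit-safe
(negatives-index form `not_…_of_not_…` included).  The collar hypothesis `closedBall y (2R) ⊆ Ω` of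
`BulkShellTight` is not needed for this direction.
-/

noncomputable section

open Set Filter Topology Metric MeasureTheory
open scoped unitInterval ENNReal
open Literature.Probability.RandomPlanarGeometry Literature.Probability.LatticeModels

namespace Summit.CriticalPhenomena.SAWScalingLimit.Theorems.BulkShellTight.Negative

open Summit.CriticalPhenomena.SAWScalingLimit.Theses.SAWRenewalTightness

/-- **`EventualTight → BulkShellTight`** (the bulk child stmt-CriticalPhenomena-17588 of the split is implied by
its parent crux stmt-CriticalPhenomena-1372): with the `δ₀` of `EventualTight` and the shell-dependent
threshold of `anyTarget_of_eventualTight` for the constant target `ε`, every shell `D(y; η, R)`,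
`0 < η < R`, interior or not, has `P_δ[j traversals] ≤ ε` for all `δ ∈ (0, δ₀]`. [folklore] -/
theorem bulkShellTight_of_eventualTight (hT : EventualTight) : BulkShellTight := by
  intro D a b hab y η R hη hηR _hcollar ε hε
  obtain ⟨δ₀, hδ₀, hany⟩ := ShellCrossingBound.Negative.anyTarget_of_eventualTight hT D a b hab
  obtain ⟨k, hk⟩ := hany (fun _ _ _ => ENNReal.ofReal ε)
    (fun _ _ _ _ _ => (ENNReal.ofReal_pos.mpr hε).ne')
  exact ⟨k y η R, δ₀, hδ₀, fun δ hδ => hk δ hδ y η R hη hηR⟩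

/-- **`¬ BulkShellTight → ¬ EventualTight`** (negatives-index form): a refutation of the bulk child refutes
the crux. [folklore] -/
theorem not_eventualTight_of_not_bulkShellTight (h : ¬ BulkShellTight) : ¬ EventualTight :=
  fun hT => h (bulkShellTight_of_eventualTight hT)

/-- **`SAWScalingLimit → BulkShellTight`**: the bulk child is a consequence of the summit conjunct
(through `EventualTight`, `EventualTight.Negative.not_sawScalingLimit_of_not_eventualTight`), i.e.
summit-safe. [folklore] -/
theorem bulkShellTight_of_sawScalingLimit (h : SAW.SAWScalingLimit) : BulkShellTight := by
  by_contra hB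
  exact EventualTight.Negative.not_sawScalingLimit_of_not_eventualTight
    (not_eventualTight_of_not_bulkShellTight hB) h

/-- **`¬ BulkShellTight → ¬ SAWScalingLimit`** (negatives-index form). [folklore] -/
theorem not_sawScalingLimit_of_not_bulkShellTight (h : ¬ BulkShellTight) : ¬ SAW.SAWScalingLimit :=
  fun h' => h (bulkShellTight_of_sawScalingLimit h')

end Summit.CriticalPhenomena.SAWScalingLimit.Theorems.BulkShellTight.Negative

end
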